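import Mathlib
import Summits.Ventures.HodgeRepro.Tier4.Line1.RTFSetting
import Summits.Ventures.HodgeRepro.Tier4.Line1.InnerCalculus
import Summits.Ventures.HodgeRepro.Tier4.Line1.InnerBridge
import Summits.Ventures.HodgeRepro.Tier4.Line1.OrthComplement
import Summits.Ventures.HodgeRepro.Tier4.Line1.MaximalFamily
import Summits.Ventures.HodgeRepro.Tier4.Line1.AdaptedONBGlue
import Summits.Ventures.HodgeRepro.Tier4.Line4.AdaptedONBPrefix
import Summits.Ventures.HodgeRepro.Tier4.Line4.AdaptedONBExtending

/-!
# Tier4/Line4/AdaptedONBAdapted3 — an adapted ONB with a finite block in EVERY constituent spanning a prescribed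
finite-dimensional subspace of it (the `(τ,K)`-split of each constituent) — hypothesis asked of IRREDUCIBLE subspaces only

Blind re-derivation cell `pub-hodge-repro`, Tier 4 «prove the step» (README §9–§10), seat t4-L4-p1 (prover, LINE L4,
gen 3; cut of record S13520, next cut S13578 (3)).  Tree path
`lean/Summits/Ventures/HodgeRepro/Tier4/Line4/AdaptedONBAdapted3.lean`.  Mathlib-level; no literature.  Generic over
any `S : RTF.Setting G`.

ERRATA (t4-L4-p1 g3, bus S13636 / crit-1 g4 S13667 F-L4-hfin): `AdaptedONBAdapted.exists_adaptedONB_adapted` asks its `hW`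
of EVERY invariant subspace, including the EMPTY set — unsatisfiable; `AdaptedONBAdapted2.exists_adaptedONB_adapted'`
asks it of every invariant subspace containing `0`, which a consumer can only meet by a finiteness hypothesis on ALL
invariant subspaces — and the maximal one (all continuous invariant functions) has an infinite-dimensional `K`-type
space on a cocompact quotient, so that consumer's hypothesis has no genuine instance either.
`exists_adaptedONB_adapted''` below asks `hW` only of IRREDUCIBLE invariant subspaces containing `0` (every constituent
of an adapted ONB is one: `{0}` or a non-zero irreducible); the consumer's finiteness hypothesis then concerns
irreducible constituents only (Harish-Chandra admissibility of irreducible unitary representations).  Same proof.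

WHAT IS PROVED.  `exists_adaptedONB_adapted''`: given a FUNCTORIAL assignment `Wfd : Set (G → ℂ) → Submodule ℂ (G → ℂ)`
of a finite-dimensional subspace `Wfd V ⊆ V` to every invariant subspace `V` (the consumer puts `Wfd V :=` the
conjugate of the `K`-type space of the conjugate constituent — the `(τ,K)`-split of `V`), under the two hypotheses of
the J1 glue (`hinf`, `h4b`), there is an adapted ONB `τ φ n` (`S.IsAdaptedONB τ φ n`) with a finite block `F m ⊆ ℕ` in
EVERY constituent `τ m` (`n j = m` on `F m`, blocks pairwise disjoint) such that `span (φ '' F m) = Wfd (τ m)` — an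
equality of submodules of FUNCTIONS.  This is the Hilbert-space half (a) of plan-4's repair (R) of the L4 wall's
residual (STATUS S13554: blocks per constituent, vanishing only WITHIN a constituent): the orthonormal basis, its blocks
and the span clauses are no longer part of the residual.  Proof: the glue's assembly (`AdaptedONBGlue`, t4-L4-p1 g0)
with, in every constituent, the Gram–Schmidt of `AdaptedONBPrefix.exists_gramSchmidt_prefix` started from the
function-level orthonormal basis of `Wfd (τ m)` (`exists_orthonormal_fun_basis`); a block index lists exactly the prefix
functions (`AdaptedONBExtending.eq_of_toL2_eq`).

HC_CM is NOT proved by anyone in this repository.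
-/

set_option autoImplicit false

noncomputable section

namespace Summit.Ventures.HodgeRepro.Tier4.Line4

open Summit.Ventures.HodgeRepro.Tier4.Line1 MeasureTheory Topology
open scoped ComplexConjugate InnerProductSpace

variable {G : Type} [Group G] [TopologicalSpace G] [IsTopologicalGroup G] [MeasurableSpace G]
  [BorelSpace G]

variable (S : RTF.Setting G)

section Adapted

/-- **An adapted ONB with a block in every constituent spanning a prescribed finite-dimensional subspace**: for a
functorial `Wfd` with `Wfd V ⊆ V` finite-dimensional on every invariant subspace `V`, under the glue's `hinf` and
`h4b`, there are `τ φ n` with `S.IsAdaptedONB τ φ n` and blocks `F : ℕ → Finset ℕ`, pairwise disjoint, `n j = m` on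
`F m`, with `span (φ '' F m) = Wfd (τ m)` for EVERY `m` (as submodules of functions `G → ℂ`). -/
theorem exists_adaptedONB_adapted'' [SecondCountableTopology G] [LocallyCompactSpace G]
    (hinf : ¬ FiniteDimensional ℂ (Lp ℂ 2 (S.μ.restrict S.DG)))
    (h4b : ∀ V : Set (G → ℂ), S.IsInvariantSubspace V →
      (∀ ψ : G → ℂ, Continuous ψ → S.Invariant ψ →
        (∀ ε : ℝ, 0 < ε → ∃ ψ' ∈ V,
          eLpNorm (fun x => ψ x - ψ' x) 2 (S.μ.restrict S.DG) < ENNReal.ofReal ε) → ψ ∈ V) →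
      (∃ ψ ∈ V, ∃ x, ψ x ≠ 0) →
      ∃ V' : Set (G → ℂ), S.IsInvariantSubspace V' ∧ V' ⊆ V ∧ S.IsIrreducible V' ∧ ∃ ψ ∈ V', ∃ x, ψ x ≠ 0)
    (Wfd : Set (G → ℂ) → Submodule ℂ (G → ℂ))
    (hW : ∀ V : Set (G → ℂ), S.IsInvariantSubspace V → S.IsIrreducible V → (0 : G → ℂ) ∈ V →
      (Wfd V : Set (G → ℂ)) ⊆ V ∧ FiniteDimensional ℂ (Wfd V)) :
    ∃ (τ : ℕ → Set (G → ℂ)) (φ : ℕ → G → ℂ) (n : ℕ → ℕ), S.IsAdaptedONB τ φ n ∧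
      ∃ F : ℕ → Finset ℕ, (∀ m m', m ≠ m' → Disjoint (F m) (F m')) ∧
        (∀ m, ∀ j ∈ F m, n j = m) ∧
        ∀ m, Submodule.span ℂ (φ '' (F m : Set ℕ)) = Wfd (τ m) := by
  classical
  haveI : Countable S.Gk := S.countable_Gk
  obtain ⟨Fam, hFam, hmax⟩ := S.exists_maximal_orthFamily
  obtain ⟨τ, hinv, hirr, horthSub, hτ0, hall⟩ := S.exists_enumeration_orthFamily hFam
  -- every constituent contains `0`
  have hzero : ∀ j, (0 : G → ℂ) ∈ τ j := by
    intro j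
    rcases hτ0 j with h | h
    · rw [h]
      exact Set.mem_singleton _
    · obtain ⟨ψ, hψ, -⟩ := (hFam.1 _ h).2.2
      have := (hinv j).smul ψ hψ 0
      have e : (fun x => (0 : ℂ) * ψ x) = (0 : G → ℂ) := by
        funext x
        simp
      rw [e] at this
      exact this
  -- function-level orthonormal bases of the `Wfd (τ j)`
  have hbasis : ∀ j : ℕ, ∃ (d : ℕ) (w : ℕ → G → ℂ), (∀ k < d, w k ∈ Wfd (τ j)) ∧
      (∀ k < d, ∀ k' < d, S.inner (w k) (w k') = if k = k' then 1 else 0) ∧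
      Submodule.span ℂ (w '' (Finset.range d : Set ℕ)) = Wfd (τ j) := fun j =>
    haveI := (hW _ (hinv j) (hirr j) (hzero j)).2
    exists_orthonormal_fun_basis S (hinv j) (Wfd (τ j)) (hW _ (hinv j) (hirr j) (hzero j)).1
  choose d w hwmem hworth hwspan using hbasis
  have hwmem' : ∀ j, ∀ k < d j, w j k ∈ τ j := fun j k hk =>
    (hW _ (hinv j) (hirr j) (hzero j)).1 (hwmem j k hk)
  -- Gram–Schmidt in every constituent, prefix kept
  have hGS : ∀ j : ℕ, ∃ g : ℕ → Lp ℂ 2 (S.μ.restrict S.DG),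
      (∀ (k : ℕ) (hk : k < d j), g k = S.toL2 ((hinv j).cont _ (hwmem' j k hk))) ∧
      (∀ k, g k ≠ 0 → g k ∈ S.clsSet (τ j)) ∧
      (∀ k k', g k ≠ 0 → g k' ≠ 0 → ⟪g k, g k'⟫_ℂ = if k = k' then 1 else 0) ∧
      ∀ u ∈ S.clsSet (τ j), ∀ v : Lp ℂ 2 (S.μ.restrict S.DG), (∀ k, ⟪g k, v⟫_ℂ = 0) → ⟪u, v⟫_ℂ = 0 :=
    fun j => exists_gramSchmidt_prefix S (hinv j) (d j) (w j) (hwmem' j) (hworth j)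
  choose g hg_pre hg_mem hg_orth hg_dense using hGS
  -- orthonormality across the whole doubly-indexed family
  have key : ∀ p q : ℕ × ℕ, g p.1 p.2 ≠ 0 → g q.1 q.2 ≠ 0 →
      ⟪g p.1 p.2, g q.1 q.2⟫_ℂ = if p = q then 1 else 0 := by
    rintro ⟨j, k⟩ ⟨j', k'⟩ hp hq
    by_cases hj : j = j'
    · subst hj
      rw [hg_orth j k k' hp hq]
      simp only [Prod.mk.injEq, true_and]
    · rw [if_neg (fun h => hj (Prod.mk.injEq _ _ _ _ ▸ h).1)]
      obtain ⟨ψ, hψ, hc, hψeq⟩ := hg_mem _ _ hp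
      obtain ⟨ψ', hψ', hc', hψ'eq⟩ := hg_mem _ _ hq
      simp only at hψeq hψ'eq
      rw [hψeq, hψ'eq, ← S.inner_eq_inner_toL2 hc' hc]
      exact horthSub j' j (Ne.symm hj) ψ' hψ' ψ hψ
  -- totality of the doubly-indexed family
  have htotal : ∀ v : Lp ℂ 2 (S.μ.restrict S.DG),
      (∀ p ∈ {p : ℕ × ℕ | g p.1 p.2 ≠ 0}, ⟪g p.1 p.2, v⟫_ℂ = 0) → v = 0 := by
    intro v hv
    have hv' : ∀ j k, ⟪g j k, v⟫_ℂ = 0 := fun j k => by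
      by_cases h : g j k = 0
      · rw [h, _root_.inner_zero_left]
      · exact hv (j, k) h
    have horth' : ∀ W ∈ Fam, ∀ ψ ∈ W, S.inner v ψ = 0 := by
      intro W hWF ψ hψ
      obtain ⟨j, hj⟩ := hall W hWF
      rw [← hj] at hψ
      have hc : Continuous ψ := (hinv j).cont ψ hψ
      have h0 : ⟪S.toL2 hc, v⟫_ℂ = 0 := hg_dense j _ ⟨ψ, hψ, hc, rfl⟩ v (hv' j)
      rw [S.inner_eq_inner_toLp (Lp.memLp v) (S.memLp_restrict_of_continuous hc), Lp.toLp_coeFn]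
      exact h0
    exact Lp.eq_zero_iff_ae_eq_zero.2 (S.ae_eq_zero_of_orth_maximal h4b hFam hmax (Lp.memLp v) horth')
  -- the index set of the non-zero vectors is infinite, hence in bijection with `ℕ`
  set P : Set (ℕ × ℕ) := {p : ℕ × ℕ | g p.1 p.2 ≠ 0} with hP
  have hPinf : P.Infinite := S.infinite_of_total hinf htotal
  haveI : Infinite ↥P := hPinf.to_subtype
  obtain ⟨hden⟩ := nonempty_denumerable ↥P
  let e : ℕ ≃ ↥P := (Denumerable.eqv ↥P).symm
  let idx : ℕ → ℕ × ℕ := fun j => ((e j : ↥P) : ℕ × ℕ)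
  have hidx : ∀ j, g (idx j).1 (idx j).2 ≠ 0 := fun j => (e j).2
  have hidx_inj : Function.Injective idx := fun j j' h => e.injective (Subtype.ext h)
  have hidx_surj : ∀ p ∈ P, ∃ j, idx j = p := fun p hp => ⟨e.symm ⟨p, hp⟩, by simp [idx]⟩
  -- pull the non-zero vectors back to members of the subspaces
  have hchoose : ∀ j : ℕ, ∃ ψ : G → ℂ, ψ ∈ τ (idx j).1 ∧ ∃ hc : Continuous ψ,
      S.toL2 hc = g (idx j).1 (idx j).2 := by
    intro j
    obtain ⟨ψ, hψ, hc, h⟩ := hg_mem _ _ (hidx j)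
    exact ⟨ψ, hψ, hc, h.symm⟩
  choose φ hφmem hφc hφeq using hchoose
  -- the prefix vectors are non-zero, so they are listed
  have hpre_ne : ∀ (m : ℕ) (k : Fin (d m)), g m k ≠ 0 := by
    intro m k h0
    have hpre := hg_pre m k k.2
    have h1 := hworth m k k.2 k k.2
    rw [if_pos rfl, S.inner_eq_inner_toL2 ((hinv m).cont _ (hwmem' m k k.2))
      ((hinv m).cont _ (hwmem' m k k.2)), ← hpre, h0] at h1
    simp at h1
  -- the blocks
  let blk : ∀ m : ℕ, Fin (d m) → ℕ := fun m k => e.symm ⟨(m, (k : ℕ)), hpre_ne m k⟩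
  have hblk_idx : ∀ (m : ℕ) (k : Fin (d m)), idx (blk m k) = (m, (k : ℕ)) := by
    intro m k
    simp [idx, blk]
  let Fb : ℕ → Finset ℕ := fun m => Finset.univ.image (blk m)
  have hmemF : ∀ (m : ℕ) (j : ℕ), j ∈ Fb m ↔ ∃ k : Fin (d m), blk m k = j := by
    intro m j
    simp only [Fb, Finset.mem_image, Finset.mem_univ, true_and]
  -- the listed function at a block index IS the prefix function
  have hφblk : ∀ (m : ℕ) (k : Fin (d m)), φ (blk m k) = w m k := by
    intro m k
    have hpre := hg_pre m k k.2
    have hφ := hφeq (blk m k)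
    rw [hblk_idx m k] at hφ
    simp only at hφ
    rw [hpre] at hφ
    have hmem : φ (blk m k) ∈ τ m := by
      have := hφmem (blk m k)
      rw [hblk_idx m k] at this
      exact this
    exact eq_of_toL2_eq S ((hinv m).inv _ hmem) (hφc (blk m k)) ((hinv m).inv _ (hwmem' m k k.2))
      ((hinv m).cont _ (hwmem' m k k.2)) hφ
  have hnF : ∀ m, ∀ j ∈ Fb m, (idx j).1 = m := by
    intro m j hj
    obtain ⟨k, rfl⟩ := (hmemF m j).1 hj
    simp only [hblk_idx m k]
  refine ⟨τ, φ, fun j => (idx j).1, ⟨hinv, hirr, horthSub, hφmem, fun j j' => ?_, fun ψ hψ hperp => ?_⟩,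
    Fb, fun m m' hne => ?_, hnF, fun m => ?_⟩
  · -- orthonormality
    rw [S.inner_eq_inner_toL2 (hφc j) (hφc j'), hφeq j', hφeq j, key _ _ (hidx j') (hidx j)]
    by_cases h : j = j'
    · subst h
      simp
    · rw [if_neg (fun h' => h (hidx_inj h').symm), if_neg h]
  · -- completeness
    have hw : ∀ p ∈ P, ⟪g p.1 p.2, hψ.toLp ψ⟫_ℂ = 0 := by
      intro p hp
      obtain ⟨j, hj⟩ := hidx_surj p hp
      have h1 := hperp j
      rw [S.inner_eq_inner_toLp hψ (S.memLp_restrict_of_continuous (hφc j))] at h1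
      have h2 : S.toL2 (hφc j) = (S.memLp_restrict_of_continuous (hφc j)).toLp (φ j) := rfl
      rw [← h2, hφeq j, hj] at h1
      exact h1
    have h0 : hψ.toLp ψ = 0 := htotal _ hw
    have hcoe := hψ.coeFn_toLp
    rw [h0] at hcoe
    exact hcoe.symm.trans (Lp.coeFn_zero ℂ 2 (S.μ.restrict S.DG))
  · -- disjointness of the blocks
    rw [Finset.disjoint_left]
    intro j hj hj'
    exact hne ((hnF m j hj).symm.trans (hnF m' j hj'))
  · -- the block spans `Wfd (τ m)`
    rw [← hwspan m]
    congr 1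
    ext f
    constructor
    · rintro ⟨j, hj, rfl⟩
      obtain ⟨k, rfl⟩ := (hmemF m j).1 (Finset.mem_coe.1 hj)
      rw [hφblk m k]
      exact ⟨k, by simp [k.2], rfl⟩
    · rintro ⟨k, hk, rfl⟩
      have hk' : k < d m := by simpa using hk
      refine ⟨blk m ⟨k, hk'⟩, Finset.mem_coe.2 ((hmemF m _).2 ⟨⟨k, hk'⟩, rfl⟩), ?_⟩
      rw [hφblk m ⟨k, hk'⟩]

end Adapted

end Summit.Ventures.HodgeRepro.Tier4.Line4

end
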